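import Literature.Analysis.FluidPDE.CylinderPairingLimits
import Literature.Analysis.FluidPDE.WeakGradientSlicing
import Literature.Analysis.FunctionSpaces.EhrlingLemma
import HarnessLib

/-!
# Strong `L²` compactness of velocities on a cylinder (Aubin–Lions via Ehrling's lemma)

Analysis/FluidPDE theorem file (no definitions, no named facts), third of three files
(`CylinderPairings`, `CylinderPairingLimits`, this one) proving the **Aubin–Lions / Friedrichs
compactness step** for the Navier–Stokes equations on a cylinder `W = (a, b) × B_R(x₀) ⊆ ℝ × ℝ³`:

> Let `(vₖ, πₖ)` be distributional solutions of the Navier–Stokes equations on `W` with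
> `ess sup_t ∫_B |vₖ(t)|² ≤ C`, `∬_W |∇vₖ|² ≤ C` (weak spatial gradients on `W`) and
> `∬_W |πₖ|^{3/2} ≤ C`. Then a subsequence converges strongly in `L²(W)`
> (`exists_subseq_tendsto_lintegral_sub_sq_cylinder`).

This is Temam 1977, Ch. III, Thm. 2.1 (with Lemma 2.1 = Ehrling) specialised to the way it is
used for suitable weak solutions (Lin 1998, Thm. 2.2; Caffarelli–Kohn–Nirenberg 1982, Appendix;
Lemarié-Rieusset 2002/2016, "Rellich–Lions" Thm. 12.1; Bradshaw–Tsai 2019, §4.3: "As usual … there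
exists … a subsequence … so that `vₖ` converges to `v` … in `L²(0,T;L²(B₁))`"). Proof: by the tree's
Ehrling lemma on the ball (`ehrling_ball`, from Rellich–Kondrachov), for every `ε` there are finitely
many test functions `φᵢ` with `‖w‖²_{L²(B)} ≤ ε (‖w‖² + ‖∇w‖²) + Σᵢ |∫_B φᵢ w|²` slice-wise; the
pairings `∫_B φᵢ v_{σ(j)}(t)` converge for a.e. `t` along the diagonal subsequence of
`exists_subseq_forall_ae_tendsto_pairing`, hence in `L²(a, b)` by dominated convergence; integrating
the slice-wise inequality in time shows that `(v_{σ(j)})` is Cauchy in `L²(W)`, and `L²(W)` is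
complete.

## References

* R. Temam, *Navier–Stokes equations* (1977), Ch. III, §2, Lemma 2.1, Thm. 2.1. [Temam1977]
* F. Lin, CPAM 51 (1998), Thm. 2.2. [Lin1998]
* L. Caffarelli, R. Kohn, L. Nirenberg, CPAM 35 (1982), Appendix. [CaffarelliKohnNirenberg1982]
* Z. Bradshaw, T.-P. Tsai, Analysis & PDE 12 (2019), §4.3. [BradshawTsai2019]
-/

noncomputable section

open MeasureTheory Set Function Filter Topology TopologicalSpace Metric
open scoped NNReal ENNReal InnerProductSpace RealInnerProductSpace Laplacian

namespace Literature.Analysis.FluidPDE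

/-! ### Elementary lemmas -/

section Elementary

/-- `‖a - b‖ₑ² ≤ 2‖a‖ₑ² + 2‖b‖ₑ²` in a seminormed group. [folklore] -/
theorem enorm_sub_sq_le_two_mul_add_two_mul {F : Type*} [SeminormedAddCommGroup F] (a b : F) :
    ‖a - b‖ₑ ^ 2 ≤ 2 * ‖a‖ₑ ^ 2 + 2 * ‖b‖ₑ ^ 2 := by
  have h0 : ‖a - b‖ ^ 2 ≤ (‖a‖ + ‖b‖) ^ 2 := pow_le_pow_left₀ (norm_nonneg _) (norm_sub_le a b) 2
  have h : ‖a - b‖ ^ 2 ≤ 2 * ‖a‖ ^ 2 + 2 * ‖b‖ ^ 2 := by nlinarith [sq_nonneg (‖a‖ - ‖b‖)]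
  calc ‖a - b‖ₑ ^ 2 = ENNReal.ofReal (‖a - b‖ ^ 2) := by
        rw [ENNReal.ofReal_pow (norm_nonneg _), ofReal_norm]
    _ ≤ ENNReal.ofReal (2 * ‖a‖ ^ 2 + 2 * ‖b‖ ^ 2) := ENNReal.ofReal_le_ofReal h
    _ = 2 * ‖a‖ₑ ^ 2 + 2 * ‖b‖ₑ ^ 2 := by
        rw [ENNReal.ofReal_add (by positivity) (by positivity), ENNReal.ofReal_mul zero_le_two,
          ENNReal.ofReal_mul zero_le_two, ENNReal.ofReal_pow (norm_nonneg _),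
          ENNReal.ofReal_pow (norm_nonneg _), ofReal_norm, ofReal_norm, ENNReal.ofReal_ofNat]

/-- The squared extended operator norm of a linear map is bounded by its Frobenius norm squared
(natural-number power form). [folklore] -/
theorem enorm_pow_two_le_ofReal_frobeniusNormSq
    (A : EuclideanSpace ℝ (Fin 3) →L[ℝ] EuclideanSpace ℝ (Fin 3)) :
    ‖A‖ₑ ^ 2 ≤ ENNReal.ofReal (frobeniusNormSq A) := by
  rw [← ofReal_norm, ← ENNReal.ofReal_pow (norm_nonneg _)]
  exact ENNReal.ofReal_le_ofReal (sq_opNorm_le_frobeniusNormSq A)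

/-- `‖y‖ₑ² = Σₗ ‖⟪y, eₗ⟫‖ₑ²` for the standard basis `eₗ = single l 1` of `ℝ³`. [folklore] -/
theorem enorm_sq_eq_sum_enorm_inner_single_sq (y : EuclideanSpace ℝ (Fin 3)) :
    ‖y‖ₑ ^ 2 = ∑ l, ‖⟪y, EuclideanSpace.single l (1 : ℝ)⟫‖ₑ ^ 2 := by
  classical
  have h1 : ∀ l, ⟪y, EuclideanSpace.single l (1 : ℝ)⟫ = y.ofLp l := fun l => by
    rw [EuclideanSpace.inner_single_right]; simp
  simp_rw [h1]
  rw [← ofReal_norm, ← ENNReal.ofReal_pow (norm_nonneg _), EuclideanSpace.norm_sq_eq,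
    ENNReal.ofReal_sum_of_nonneg (fun i _ => by positivity)]
  refine Finset.sum_congr rfl fun l _ => ?_
  rw [ENNReal.ofReal_pow (norm_nonneg _), ofReal_norm]

/-- The components of `∫_B φ (w₁ - w₂)` along a vector `e` are differences of the pairings
`∫_B ⟪wᵢ, φ e⟫`. [folklore] -/
theorem inner_setIntegral_smul_sub_eq {B : Set (EuclideanSpace ℝ (Fin 3))}
    {w₁ w₂ : EuclideanSpace ℝ (Fin 3) → EuclideanSpace ℝ (Fin 3)} {φ : EuclideanSpace ℝ (Fin 3) → ℝ}
    (h₁ : IntegrableOn (fun x => φ x • w₁ x) B volume)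
    (h₂ : IntegrableOn (fun x => φ x • w₂ x) B volume) (e : EuclideanSpace ℝ (Fin 3)) :
    ⟪∫ x in B, φ x • (w₁ x - w₂ x), e⟫ =
      (∫ x in B, ⟪w₁ x, φ x • e⟫) - ∫ x in B, ⟪w₂ x, φ x • e⟫ := by
  have e1 : ∫ x in B, φ x • (w₁ x - w₂ x) = (∫ x in B, φ x • w₁ x) - ∫ x in B, φ x • w₂ x := by
    rw [← integral_sub h₁ h₂]
    exact integral_congr_ae (Eventually.of_forall fun x => by simp only [smul_sub])
  have e2 : ∀ {w : EuclideanSpace ℝ (Fin 3) → EuclideanSpace ℝ (Fin 3)},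
      IntegrableOn (fun x => φ x • w x) B volume →
      ⟪∫ x in B, φ x • w x, e⟫ = ∫ x in B, ⟪w x, φ x • e⟫ := by
    intro w hw
    rw [real_inner_comm, ← integral_inner hw e]
    refine integral_congr_ae (Eventually.of_forall fun x => ?_)
    simp only [real_inner_smul_right]
    rw [real_inner_comm]
  rw [e1, inner_sub_left, e2 h₁, e2 h₂]

/-- **Dominated convergence for a.e. convergent, uniformly bounded sequences of pairings**: if
`hₙ` converges a.e. on a finite measure space with `‖hₙ‖ₑ ≤ M < ∞` a.e., then for the
(a.e.-strongly measurable) limit `L`, `∫⁻ ‖hₙ - L‖ₑ² → 0`. [folklore] -/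
theorem exists_tendsto_lintegral_enorm_sub_sq {X : Type*} [MeasurableSpace X] {μ : Measure X}
    [IsFiniteMeasure μ] {h : ℕ → X → ℝ} (hm : ∀ n, AEStronglyMeasurable (h n) μ) {M : ℝ≥0∞}
    (hM : M ≠ ∞) (hbd : ∀ n, ∀ᵐ t ∂μ, ‖h n t‖ₑ ≤ M)
    (hlim : ∀ᵐ t ∂μ, ∃ l, Tendsto (fun n => h n t) atTop (𝓝 l)) :
    ∃ L : X → ℝ, AEStronglyMeasurable L μ ∧
      Tendsto (fun n => ∫⁻ t, ‖h n t - L t‖ₑ ^ 2 ∂μ) atTop (𝓝 0) := by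
  set L : X → ℝ := fun t => limUnder atTop (fun n => h n t) with hL
  have hLt : ∀ᵐ t ∂μ, Tendsto (fun n => h n t) atTop (𝓝 (L t)) := by
    filter_upwards [hlim] with t ht
    exact tendsto_nhds_limUnder ht
  have hLm : AEStronglyMeasurable L μ := aestronglyMeasurable_of_tendsto_ae atTop hm hLt
  have hall : ∀ᵐ t ∂μ, ∀ n, ‖h n t‖ₑ ≤ M := ae_all_iff.2 hbd
  have hLbd : ∀ᵐ t ∂μ, ‖L t‖ₑ ≤ M := by
    filter_upwards [hLt, hall] with t ht hb
    exact le_of_tendsto ht.enorm (Eventually.of_forall hb)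
  refine ⟨L, hLm, ?_⟩
  have key := tendsto_lintegral_of_dominated_convergence' (μ := μ)
    (F := fun n t => ‖h n t - L t‖ₑ ^ 2) (f := fun _ => 0) (fun _ => (M + M) ^ 2)
    (fun n => (((hm n).sub hLm).aemeasurable.enorm.pow_const 2)) (fun n => by
      filter_upwards [hbd n, hLbd] with t h1 h2
      calc ‖h n t - L t‖ₑ ^ 2 ≤ (‖h n t‖ₑ + ‖L t‖ₑ) ^ 2 := by
            gcongr; exact enorm_sub_le
        _ ≤ (M + M) ^ 2 := by gcongr) (by
      rw [lintegral_const]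
      exact ENNReal.mul_ne_top (ENNReal.pow_ne_top (ENNReal.add_ne_top.2 ⟨hM, hM⟩))
        (measure_ne_top μ _)) (by
      filter_upwards [hLt] with t ht
      have h1 : Tendsto (fun n => h n t - L t) atTop (𝓝 0) := by
        simpa using ht.sub_const (L t)
      have h2 := ENNReal.Tendsto.pow (n := 2) h1.enorm
      simpa using h2)
  simpa using key

end Elementary

/-! ### Slices -/

section Slices

variable {a b : ℝ} {v : ℝ → EuclideanSpace ℝ (Fin 3) → EuclideanSpace ℝ (Fin 3)}

/-- Slices of a field with `∫_B |v(t)|² ≤ C` for a.e. `t` are in `L²(B)` for a.e. `t`. [folklore] -/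
theorem ae_memLp_two_slice_cylinder {B : Set (EuclideanSpace ℝ (Fin 3))} {C : ℝ≥0}
    (hm : AEStronglyMeasurable (uncurry v)
      ((volume : Measure (ℝ × EuclideanSpace ℝ (Fin 3))).restrict (Ioo a b ×ˢ B)))
    (hE : ∀ᵐ t ∂((volume : Measure ℝ).restrict (Ioo a b)), ∫⁻ x in B, ‖v t x‖ₑ ^ 2 ≤ C) :
    ∀ᵐ t ∂((volume : Measure ℝ).restrict (Ioo a b)),
      MemLp (v t) 2 ((volume : Measure (EuclideanSpace ℝ (Fin 3))).restrict B) := by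
  filter_upwards [ae_aestronglyMeasurable_slice_cylinder hm, hE] with t h1 h2
  exact memLp_two_of_aestronglyMeasurable_of_lintegral_sq_lt_top h1 (h2.trans_lt ENNReal.coe_lt_top)

/-- A bounded continuous multiple of an `L²(B)` field is integrable on a set `B` of finite measure.
[folklore] -/
theorem integrableOn_smul_of_memLp_two {B : Set (EuclideanSpace ℝ (Fin 3))} (hB : volume B ≠ ∞)
    {w : EuclideanSpace ℝ (Fin 3) → EuclideanSpace ℝ (Fin 3)}
    (hw : MemLp w 2 ((volume : Measure (EuclideanSpace ℝ (Fin 3))).restrict B))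
    {φ : EuclideanSpace ℝ (Fin 3) → ℝ} (hφc : Continuous φ) {K : ℝ} (hK : ∀ x, ‖φ x‖ ≤ K) :
    IntegrableOn (fun x => φ x • w x) B volume := by
  haveI : IsFiniteMeasure ((volume : Measure (EuclideanSpace ℝ (Fin 3))).restrict B) :=
    isFiniteMeasure_restrict.2 hB
  have h1 : Integrable w ((volume : Measure (EuclideanSpace ℝ (Fin 3))).restrict B) :=
    hw.integrable one_le_two
  refine Integrable.mono' (h1.norm.const_mul K) (hφc.aestronglyMeasurable.smul hw.1)
    (Eventually.of_forall fun x => ?_)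
  rw [norm_smul]
  gcongr
  exact hK x

end Slices

/-! ### The compactness theorem -/

section Main

variable {x₀ : EuclideanSpace ℝ (Fin 3)} {R a b ν : ℝ}
  {v : ℕ → ℝ → EuclideanSpace ℝ (Fin 3) → EuclideanSpace ℝ (Fin 3)}
  {π : ℕ → ℝ → EuclideanSpace ℝ (Fin 3) → ℝ}

set_option maxHeartbeats 800000 in
/-- **Aubin–Lions on a cylinder: strong `L²` compactness of bounded sequences of distributional
Navier–Stokes solutions.** Let `(vₖ, πₖ)` be distributional solutions (viscosity `ν`, no force) on
`W = (a, b) × B_R(x₀)` with, for one constant `C`, `∫_B |vₖ(t)|² ≤ C` for a.e. `t ∈ (a, b)`, a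
weak spatial gradient `Gₖ` on `W` with `∬_W |Gₖ|² ≤ C`, and `∬_W |πₖ|^{3/2} ≤ C`, for every `k`.
Then there are a subsequence `σ` and `u ∈ L²(W)` with `∬_W |v_{σ(j)} - u|² → 0` (Temam 1977,
Ch. III, Thm. 2.1 via Lemma 2.1 (Ehrling); Lin 1998, Thm. 2.2; Bradshaw–Tsai 2019, §4.3).
[cite: Temam1977, Ch. III §2 Thm. 2.1] -/
theorem exists_subseq_tendsto_lintegral_sub_sq_cylinder {C : ℝ≥0}
    (hsol : ∀ k, IsDistributionalNSSolutionOn (timeCylinder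
      (⟨ball x₀ R, isOpen_ball⟩ : Opens (EuclideanSpace ℝ (Fin 3))) a b) ν 0 (v k) (π k))
    (hE : ∀ k, ∀ᵐ t ∂((volume : Measure ℝ).restrict (Ioo a b)),
      ∫⁻ x in ball x₀ R, ‖v k t x‖ₑ ^ 2 ≤ C)
    (hG : ∀ k, ∃ G : ℝ → EuclideanSpace ℝ (Fin 3) →
        EuclideanSpace ℝ (Fin 3) →L[ℝ] EuclideanSpace ℝ (Fin 3),
      HasWeakSpatialGradientOn (timeCylinder
        (⟨ball x₀ R, isOpen_ball⟩ : Opens (EuclideanSpace ℝ (Fin 3))) a b) (v k) G ∧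
      ∫⁻ z in Ioo a b ×ˢ ball x₀ R, ENNReal.ofReal (frobeniusNormSq (G z.1 z.2)) ≤ C)
    (hP : ∀ k, ∫⁻ z in Ioo a b ×ˢ ball x₀ R, ‖π k z.1 z.2‖ₑ ^ (3 / 2 : ℝ) ≤ C) :
    ∃ σ : ℕ → ℕ, StrictMono σ ∧
      ∃ u : ℝ → EuclideanSpace ℝ (Fin 3) → EuclideanSpace ℝ (Fin 3),
        MemLp (uncurry u) 2
          ((volume : Measure (ℝ × EuclideanSpace ℝ (Fin 3))).restrict (Ioo a b ×ˢ ball x₀ R)) ∧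
        Tendsto (fun j => ∫⁻ z in Ioo a b ×ˢ ball x₀ R, ‖v (σ j) z.1 z.2 - u z.1 z.2‖ₑ ^ 2)
          atTop (𝓝 0) := by
  classical
  set B : Set (EuclideanSpace ℝ (Fin 3)) := ball x₀ R with hB
  set μS : Measure (ℝ × EuclideanSpace ℝ (Fin 3)) :=
    (volume : Measure (ℝ × EuclideanSpace ℝ (Fin 3))).restrict (Ioo a b ×ˢ B) with hμS
  set μt : Measure ℝ := (volume : Measure ℝ).restrict (Ioo a b) with hμt
  set μB : Measure (EuclideanSpace ℝ (Fin 3)) :=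
    (volume : Measure (EuclideanSpace ℝ (Fin 3))).restrict B with hμB
  haveI : IsFiniteMeasure μS := isFiniteMeasure_restrict_cylinder a b x₀ R
  haveI : IsFiniteMeasure μt := ⟨by
    rw [hμt, Measure.restrict_apply_univ, Real.volume_Ioo]; exact ENNReal.ofReal_lt_top⟩
  have hBtop : volume B ≠ ∞ := measure_ball_lt_top.ne
  have hIoo : volume (Ioo a b) < ∞ := by rw [Real.volume_Ioo]; exact ENNReal.ofReal_lt_top
  have hμS_prod : μS = μt.prod μB := volume_restrict_cylinder_eq_prod a b B
  -- ## integrability classes on the cylinder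
  have hmv : ∀ k, AEStronglyMeasurable (uncurry (v k)) μS := fun k => (hsol k).1.aestronglyMeasurable
  have hmπ : ∀ k, AEStronglyMeasurable (uncurry (π k)) μS :=
    fun k => (hsol k).2.2.1.aestronglyMeasurable
  have hv2 : ∀ k, MemLp (uncurry (v k)) 2 μS := fun k =>
    memLp_two_of_aestronglyMeasurable_of_lintegral_sq_lt_top (hmv k)
      (lt_of_le_of_lt (setLIntegral_cylinder_enorm_sq_le (hmv k) (hE k))
        (ENNReal.mul_lt_top ENNReal.coe_lt_top hIoo))
  have hπ1 : ∀ k, Integrable (uncurry (π k)) μS := fun k => by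
    refine ⟨hmπ k, ?_⟩
    refine lt_of_le_of_lt (setLIntegral_enorm_le_of_three_halves (μ := volume) (S := Ioo a b ×ˢ B)
      (p := uncurry (π k)) (hmπ k)) (ENNReal.mul_lt_top ?_ ?_)
    · exact ENNReal.rpow_lt_top_of_nonneg (by norm_num) (volume_cylinder_lt_top a b x₀ R).ne
    · exact ENNReal.rpow_lt_top_of_nonneg (by norm_num)
        (ne_top_of_le_ne_top ENNReal.coe_ne_top (hP k))
  choose G hGw hGb using hG
  have hmG : ∀ k, AEStronglyMeasurable (uncurry (G k)) μS :=
    fun k => (hGw k).locallyIntegrableOn_grad.aestronglyMeasurable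
  -- slices: weak derivatives and `L²` membership for a.e. time, all `k` at once
  have hslice : ∀ᵐ t ∂μt, ∀ k, FunctionSpaces.HasWeakFDerivOn
      (⟨ball x₀ R, isOpen_ball⟩ : Opens (EuclideanSpace ℝ (Fin 3))) volume (v k t) (G k t) ∧
      MemLp (v k t) 2 μB := by
    rw [ae_all_iff]
    intro k
    filter_upwards [(hGw k).ae_hasWeakFDerivOn_slice, ae_memLp_two_slice_cylinder (hmv k) (hE k)]
      with t h1 h2
    exact ⟨h1, h2⟩
  -- ## Step 1: Ehrling's test functions at all scales `(m+1)⁻¹`, and the vector test fields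
  have hεm : ∀ m : ℕ, ((m : ℝ≥0∞) + 1)⁻¹ ≠ 0 := fun m => ENNReal.inv_ne_zero.2 (by simp)
  choose n φ hφ hEhr using fun m : ℕ =>
    FunctionSpaces.ehrling_ball (F := EuclideanSpace ℝ (Fin 3)) x₀ R
      (volume : Measure (EuclideanSpace ℝ (Fin 3))) (hεm m)
  have hφK : ∀ m i, ∃ K : ℝ, ∀ x, ‖φ m i x‖ ≤ K := fun m i =>
    (hφ m i).contDiff.continuous.bounded_above_of_compact_support (hφ m i).hasCompactSupport
  choose Kφ hKφ using hφK
  set η : (Σ m, Fin (n m)) × Fin 3 → EuclideanSpace ℝ (Fin 3) → EuclideanSpace ℝ (Fin 3) :=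
    fun q x => φ q.1.1 q.1.2 x • EuclideanSpace.single q.2 (1 : ℝ) with hη
  have hηt : ∀ q, FunctionSpaces.IsTestFunctionOn
      (⟨ball x₀ R, isOpen_ball⟩ : Opens (EuclideanSpace ℝ (Fin 3))) (η q) := fun q =>
    { contDiff := (hφ _ _).contDiff.smul contDiff_const
      hasCompactSupport := (hφ _ _).hasCompactSupport.smul_right
      tsupport_subset := (tsupport_smul_subset_left _ _).trans (hφ _ _).tsupport_subset }
  -- ## Step 2: the diagonal subsequence and the `L²(a,b)` convergence of the pairings
  obtain ⟨σ, hσ, hconv⟩ := exists_subseq_forall_ae_tendsto_pairing hsol hE hP hηt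
  set g : ℕ → ((Σ m, Fin (n m)) × Fin 3) → ℝ → ℝ :=
    fun k q t => ∫ x in B, ⟪v k t x, η q x⟫ with hg
  have hgm : ∀ k q, AEStronglyMeasurable (g k q) μt := fun k q =>
    (integrableOn_pairing_cylinder (ν := ν) (hv2 k) (hπ1 k) (hηt q)).1.aestronglyMeasurable
  have hηK : ∀ q, ∃ K₀ K₁ K₂ : ℝ, (∀ x, ‖η q x‖ ≤ K₀) ∧ (∀ x, ‖fderiv ℝ (η q) x‖ ≤ K₁) ∧
      ∀ x, ‖Δ (η q) x‖ ≤ K₂ := fun q => exists_bounds_of_isTestFunctionOn (hηt q)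
  choose K₀ K₁ K₂ hK₀ hK₁ hK₂ using hηK
  have hgM : ∀ k q, ∀ᵐ t ∂μt, ‖g k q t‖ₑ ≤ ENNReal.ofReal (K₀ q) * (volume B + C) :=
    fun k q => ae_enorm_pairing_le (hE k) (hK₀ q)
  have hD : ∀ q, ∃ L : ℝ → ℝ, AEStronglyMeasurable L μt ∧
      Tendsto (fun j => ∫⁻ t, ‖g (σ j) q t - L t‖ₑ ^ 2 ∂μt) atTop (𝓝 0) := fun q =>
    exists_tendsto_lintegral_enorm_sub_sq (fun j => hgm (σ j) q)
      (ENNReal.mul_ne_top ENNReal.ofReal_ne_top (ENNReal.add_ne_top.2 ⟨hBtop, ENNReal.coe_ne_top⟩))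
      (fun j => hgM (σ j) q) (hconv q)
  choose L hLm hL using hD
  -- ## Step 3: the Cauchy estimate in `L²(W)`
  have hCauchy : ∀ ε : ℝ≥0∞, 0 < ε → ∃ N, ∀ j ≥ N, ∀ j' ≥ N,
      ∫⁻ z in Ioo a b ×ˢ B, ‖v (σ j) z.1 z.2 - v (σ j') z.1 z.2‖ₑ ^ 2 ≤ ε := by
    intro ε hε
    -- the scale `m`
    set Etot : ℝ≥0∞ := (2 * C + 2 * C) * volume (Ioo a b) + (2 * C + 2 * C) with hEtot
    have h2C : (2 : ℝ≥0∞) * C ≠ ∞ := ENNReal.mul_ne_top ENNReal.ofNat_ne_top ENNReal.coe_ne_top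
    have h4C : (2 : ℝ≥0∞) * C + 2 * C ≠ ∞ := ENNReal.add_ne_top.2 ⟨h2C, h2C⟩
    have hEtop : Etot ≠ ∞ := ENNReal.add_ne_top.2 ⟨ENNReal.mul_ne_top h4C hIoo.ne, h4C⟩
    obtain ⟨m, hm⟩ : ∃ m : ℕ, ((m : ℝ≥0∞) + 1)⁻¹ * Etot ≤ ε / 2 := by
      rcases eq_or_ne Etot 0 with h0 | h0
      · exact ⟨0, by simp [h0]⟩
      · obtain ⟨m, hm⟩ := ENNReal.exists_inv_nat_lt (a := ε / 2 / Etot)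
          (ENNReal.div_pos (ENNReal.div_pos hε.ne' (by simp)).ne' hEtop).ne'
        refine ⟨m, ?_⟩
        calc ((m : ℝ≥0∞) + 1)⁻¹ * Etot ≤ (m : ℝ≥0∞)⁻¹ * Etot := by
              gcongr; exact le_self_add
          _ ≤ ε / 2 / Etot * Etot := by gcongr
          _ = ε / 2 := ENNReal.div_mul_cancel h0 hEtop
    -- the pairing error at scale `m`
    set F : ℕ → ℝ≥0∞ := fun j => ∑ q : Fin (n m) × Fin 3,
      ∫⁻ t, ‖g (σ j) ⟨⟨m, q.1⟩, q.2⟩ t - L ⟨⟨m, q.1⟩, q.2⟩ t‖ₑ ^ 2 ∂μt with hF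
    have hF0 : Tendsto (fun j => 2 * F j) atTop (𝓝 0) := by
      have h1 : Tendsto F atTop (𝓝 0) := by
        have := tendsto_finsetSum (Finset.univ : Finset (Fin (n m) × Fin 3))
          (fun q _ => hL ⟨⟨m, q.1⟩, q.2⟩)
        simpa using this
      simpa using ENNReal.Tendsto.const_mul h1 (Or.inr ENNReal.ofNat_ne_top)
    have hε4 : 0 < ε / 2 / 2 := ENNReal.div_pos (ENNReal.div_pos hε.ne' (by simp)).ne' (by simp)
    obtain ⟨N, hN⟩ := eventually_atTop.1 (hF0.eventually_lt_const hε4)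
    refine ⟨N, fun j hj j' hj' => ?_⟩
    -- ### the slice-wise Ehrling inequality, integrated
    -- notation for the two indices
    set k₁ := σ j with hk₁
    set k₂ := σ j' with hk₂
    set e₁ : ℝ → ℝ≥0∞ := fun t => ∫⁻ x in B, ‖v k₁ t x - v k₂ t x‖ₑ ^ 2 with he₁
    set e₂ : ℝ → ℝ≥0∞ := fun t => ∫⁻ x in B, ‖G k₁ t x - G k₂ t x‖ₑ ^ 2 with he₂
    set P : ℝ → ℝ≥0∞ := fun t => ∑ q : Fin (n m) × Fin 3,
      ‖g k₁ ⟨⟨m, q.1⟩, q.2⟩ t - g k₂ ⟨⟨m, q.1⟩, q.2⟩ t‖ₑ ^ 2 with hPdef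
    -- (a) the slice-wise inequality
    have hae : ∀ᵐ t ∂μt, e₁ t ≤ ((m : ℝ≥0∞) + 1)⁻¹ * (e₁ t + e₂ t) + P t := by
      filter_upwards [hslice] with t ht
      obtain ⟨hw₁, hL₁⟩ := ht k₁
      obtain ⟨hw₂, hL₂⟩ := ht k₂
      have hEt := hEhr m (v k₁ t - v k₂ t) (G k₁ t - G k₂ t) (hw₁.sub hw₂)
      have eq₁ : eLpNorm (v k₁ t - v k₂ t) 2 μB ^ 2 = e₁ t := by
        rw [MollifiedLimits.eLpNorm_two_pow_two]; rfl
      have eq₂ : eLpNorm (G k₁ t - G k₂ t) 2 μB ^ 2 = e₂ t := by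
        rw [MollifiedLimits.eLpNorm_two_pow_two]; rfl
      have eq₃ : ∑ i, ‖∫ x in ball x₀ R, φ m i x • (v k₁ t - v k₂ t) x‖ₑ ^ 2 = P t := by
        rw [hPdef]
        dsimp only
        rw [← Finset.univ_product_univ, Finset.sum_product]
        refine Finset.sum_congr rfl fun i _ => ?_
        rw [enorm_sq_eq_sum_enorm_inner_single_sq]
        refine Finset.sum_congr rfl fun l _ => ?_
        have hi₁ := integrableOn_smul_of_memLp_two hBtop hL₁ (hφ m i).contDiff.continuous (hKφ m i)
        have hi₂ := integrableOn_smul_of_memLp_two hBtop hL₂ (hφ m i).contDiff.continuous (hKφ m i)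
        have := inner_setIntegral_smul_sub_eq hi₁ hi₂ (EuclideanSpace.single l (1 : ℝ))
        simp only [Pi.sub_apply] at this ⊢
        rw [this]
      rw [eq₁, eq₂, eq₃] at hEt
      exact hEt
    -- (b) measurability of the three functions of time
    have me₁ : AEMeasurable e₁ μt := by
      have h := (((hmv k₁).sub (hmv k₂)).aemeasurable.enorm.pow_const 2)
      rw [hμS_prod] at h
      exact h.lintegral_prod_right'
    have me₂ : AEMeasurable e₂ μt := by
      have h := (((hmG k₁).sub (hmG k₂)).aemeasurable.enorm.pow_const 2)
      rw [hμS_prod] at h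
      exact h.lintegral_prod_right'
    have mP : ∀ q : Fin (n m) × Fin 3, AEMeasurable
        (fun t => ‖g k₁ ⟨⟨m, q.1⟩, q.2⟩ t - g k₂ ⟨⟨m, q.1⟩, q.2⟩ t‖ₑ ^ 2) μt := fun q =>
      ((hgm k₁ _).sub (hgm k₂ _)).aemeasurable.enorm.pow_const 2
    -- (c) the three integrated bounds
    have hslice_e₁ : ∀ᵐ t ∂μt, e₁ t ≤ 2 * C + 2 * C := by
      filter_upwards [hE k₁, hE k₂, ae_aestronglyMeasurable_slice_cylinder (hmv k₁),
        ae_aestronglyMeasurable_slice_cylinder (hmv k₂)] with t h1 h2 h3 h4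
      calc e₁ t ≤ ∫⁻ x in B, (2 * ‖v k₁ t x‖ₑ ^ 2 + 2 * ‖v k₂ t x‖ₑ ^ 2) :=
            lintegral_mono fun x => enorm_sub_sq_le_two_mul_add_two_mul _ _
        _ = 2 * (∫⁻ x in B, ‖v k₁ t x‖ₑ ^ 2) + 2 * ∫⁻ x in B, ‖v k₂ t x‖ₑ ^ 2 := by
            have ma : AEMeasurable (fun x => 2 * ‖v k₁ t x‖ₑ ^ 2) μB :=
              (h3.aemeasurable.enorm.pow_const 2).const_mul _
            rw [lintegral_add_left' ma, lintegral_const_mul' _ _ ENNReal.ofNat_ne_top,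
              lintegral_const_mul' _ _ ENNReal.ofNat_ne_top]
        _ ≤ 2 * C + 2 * C := by gcongr
    have hI₁ : ∫⁻ t, e₁ t ∂μt ≤ (2 * C + 2 * C) * volume (Ioo a b) :=
      calc ∫⁻ t, e₁ t ∂μt ≤ ∫⁻ _, (2 * C + 2 * C) ∂μt := lintegral_mono_ae hslice_e₁
        _ = (2 * C + 2 * C) * volume (Ioo a b) := by
            rw [lintegral_const, hμt, Measure.restrict_apply_univ]
    have hI₂ : ∫⁻ t, e₂ t ∂μt ≤ 2 * C + 2 * C := by
      have hT : ∫⁻ t, e₂ t ∂μt = ∫⁻ z in Ioo a b ×ˢ B, ‖G k₁ z.1 z.2 - G k₂ z.1 z.2‖ₑ ^ 2 := by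
        rw [he₂, setLIntegral_cylinder_eq (F := fun z => ‖G k₁ z.1 z.2 - G k₂ z.1 z.2‖ₑ ^ 2)]
        exact ((hmG k₁).sub (hmG k₂)).aemeasurable.enorm.pow_const 2
      rw [hT]
      calc ∫⁻ z in Ioo a b ×ˢ B, ‖G k₁ z.1 z.2 - G k₂ z.1 z.2‖ₑ ^ 2
          ≤ ∫⁻ z in Ioo a b ×ˢ B, (2 * ‖G k₁ z.1 z.2‖ₑ ^ 2 + 2 * ‖G k₂ z.1 z.2‖ₑ ^ 2) :=
            lintegral_mono fun z => enorm_sub_sq_le_two_mul_add_two_mul _ _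
        _ = 2 * (∫⁻ z in Ioo a b ×ˢ B, ‖G k₁ z.1 z.2‖ₑ ^ 2) +
              2 * ∫⁻ z in Ioo a b ×ˢ B, ‖G k₂ z.1 z.2‖ₑ ^ 2 := by
            have ma : AEMeasurable (fun z : ℝ × EuclideanSpace ℝ (Fin 3) =>
                2 * ‖G k₁ z.1 z.2‖ₑ ^ 2) μS :=
              ((hmG k₁).aemeasurable.enorm.pow_const 2).const_mul _
            rw [lintegral_add_left' ma, lintegral_const_mul' _ _ ENNReal.ofNat_ne_top,
              lintegral_const_mul' _ _ ENNReal.ofNat_ne_top]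
        _ ≤ 2 * C + 2 * C := by
            gcongr
            · exact (lintegral_mono fun z => enorm_pow_two_le_ofReal_frobeniusNormSq _).trans (hGb k₁)
            · exact (lintegral_mono fun z => enorm_pow_two_le_ofReal_frobeniusNormSq _).trans (hGb k₂)
    have hI₃ : ∫⁻ t, P t ∂μt ≤ 2 * F j + 2 * F j' := by
      rw [hPdef, lintegral_finsetSum' _ fun q _ => mP q, hF]
      dsimp only
      rw [Finset.mul_sum, Finset.mul_sum, ← Finset.sum_add_distrib]
      refine Finset.sum_le_sum fun q _ => ?_
      calc ∫⁻ t, ‖g k₁ ⟨⟨m, q.1⟩, q.2⟩ t - g k₂ ⟨⟨m, q.1⟩, q.2⟩ t‖ₑ ^ 2 ∂μt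
          ≤ ∫⁻ t, (2 * ‖g k₁ ⟨⟨m, q.1⟩, q.2⟩ t - L ⟨⟨m, q.1⟩, q.2⟩ t‖ₑ ^ 2 +
              2 * ‖g k₂ ⟨⟨m, q.1⟩, q.2⟩ t - L ⟨⟨m, q.1⟩, q.2⟩ t‖ₑ ^ 2) ∂μt := by
            refine lintegral_mono fun t => ?_
            have := enorm_sub_sq_le_two_mul_add_two_mul (g k₁ ⟨⟨m, q.1⟩, q.2⟩ t - L ⟨⟨m, q.1⟩, q.2⟩ t)
              (g k₂ ⟨⟨m, q.1⟩, q.2⟩ t - L ⟨⟨m, q.1⟩, q.2⟩ t)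
            rwa [sub_sub_sub_cancel_right] at this
        _ = 2 * ∫⁻ t, ‖g k₁ ⟨⟨m, q.1⟩, q.2⟩ t - L ⟨⟨m, q.1⟩, q.2⟩ t‖ₑ ^ 2 ∂μt +
              2 * ∫⁻ t, ‖g k₂ ⟨⟨m, q.1⟩, q.2⟩ t - L ⟨⟨m, q.1⟩, q.2⟩ t‖ₑ ^ 2 ∂μt := by
            have ma : AEMeasurable
                (fun t => 2 * ‖g k₁ ⟨⟨m, q.1⟩, q.2⟩ t - L ⟨⟨m, q.1⟩, q.2⟩ t‖ₑ ^ 2) μt :=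
              (((hgm k₁ _).sub (hLm _)).aemeasurable.enorm.pow_const 2).const_mul _
            rw [lintegral_add_left' ma, lintegral_const_mul' _ _ ENNReal.ofNat_ne_top,
              lintegral_const_mul' _ _ ENNReal.ofNat_ne_top]
    -- (d) assembling the estimate
    have hT₁ : ∫⁻ z in Ioo a b ×ˢ B, ‖v k₁ z.1 z.2 - v k₂ z.1 z.2‖ₑ ^ 2 = ∫⁻ t, e₁ t ∂μt := by
      rw [he₁, setLIntegral_cylinder_eq (F := fun z => ‖v k₁ z.1 z.2 - v k₂ z.1 z.2‖ₑ ^ 2)]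
      exact ((hmv k₁).sub (hmv k₂)).aemeasurable.enorm.pow_const 2
    rw [hT₁]
    have m12 : AEMeasurable (fun t => e₁ t + e₂ t) μt := me₁.add me₂
    have hmtop : ((m : ℝ≥0∞) + 1)⁻¹ ≠ ∞ := ENNReal.inv_ne_top.2 (by positivity)
    calc ∫⁻ t, e₁ t ∂μt ≤ ∫⁻ t, (((m : ℝ≥0∞) + 1)⁻¹ * (e₁ t + e₂ t) + P t) ∂μt :=
          lintegral_mono_ae hae
      _ = ((m : ℝ≥0∞) + 1)⁻¹ * (∫⁻ t, e₁ t ∂μt + ∫⁻ t, e₂ t ∂μt) + ∫⁻ t, P t ∂μt := by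
          rw [lintegral_add_left' (m12.const_mul _), lintegral_const_mul' _ _ hmtop,
            lintegral_add_left' me₁]
      _ ≤ ((m : ℝ≥0∞) + 1)⁻¹ * Etot + (2 * F j + 2 * F j') :=
          add_le_add (by gcongr; exact add_le_add hI₁ hI₂) hI₃
      _ ≤ ε / 2 + (ε / 2 / 2 + ε / 2 / 2) :=
          add_le_add hm (add_le_add (hN j hj).le (hN j' hj').le)
      _ = ε := by rw [ENNReal.add_halves, ENNReal.add_halves]
  -- ## Step 4: the limit in the complete space `L²(W)`
  set U : ℕ → Lp (EuclideanSpace ℝ (Fin 3)) 2 μS := fun j => (hv2 (σ j)).toLp (uncurry (v (σ j)))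
    with hU
  have hUsub : ∀ j j', eLpNorm (⇑(U j) - ⇑(U j')) 2 μS ^ 2 =
      ∫⁻ z in Ioo a b ×ˢ B, ‖v (σ j) z.1 z.2 - v (σ j') z.1 z.2‖ₑ ^ 2 := by
    intro j j'
    rw [eLpNorm_congr_ae ((hv2 (σ j)).coeFn_toLp.sub (hv2 (σ j')).coeFn_toLp),
      MollifiedLimits.eLpNorm_two_pow_two]
    rfl
  have hUc : CauchySeq U := by
    rw [Metric.cauchySeq_iff]
    intro ε hε
    obtain ⟨N, hN⟩ := hCauchy (ENNReal.ofReal (ε / 2) ^ 2)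
      (ENNReal.pow_pos (ENNReal.ofReal_pos.2 (by linarith)) 2)
    refine ⟨N, fun j hj j' hj' => ?_⟩
    rw [Lp.dist_def]
    have h1 : eLpNorm (⇑(U j) - ⇑(U j')) 2 μS ≤ ENNReal.ofReal (ε / 2) := by
      rw [← ENNReal.pow_le_pow_left_iff two_ne_zero, hUsub]
      exact hN j hj j' hj'
    calc (eLpNorm (⇑(U j) - ⇑(U j')) 2 μS).toReal ≤ ε / 2 :=
          ENNReal.toReal_le_of_le_ofReal (by positivity) h1
      _ < ε := by linarith
  obtain ⟨Ul, hUl⟩ := cauchySeq_tendsto_of_complete hUc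
  refine ⟨σ, hσ, fun t x =>
    (Ul : ℝ × EuclideanSpace ℝ (Fin 3) → EuclideanSpace ℝ (Fin 3)) (t, x), ?_, ?_⟩
  · have e : uncurry (fun t x =>
        (Ul : ℝ × EuclideanSpace ℝ (Fin 3) → EuclideanSpace ℝ (Fin 3)) (t, x)) =
        (Ul : ℝ × EuclideanSpace ℝ (Fin 3) → EuclideanSpace ℝ (Fin 3)) := by
      funext z; rfl
    rw [e]
    exact Lp.memLp Ul
  · have h1 := (Lp.tendsto_Lp_iff_tendsto_eLpNorm' U Ul).1 hUl
    have h2 : ∀ j, eLpNorm (⇑(U j) - ⇑Ul) 2 μS ^ 2 = ∫⁻ z in Ioo a b ×ˢ B,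
        ‖v (σ j) z.1 z.2 -
          (Ul : ℝ × EuclideanSpace ℝ (Fin 3) → EuclideanSpace ℝ (Fin 3)) (z.1, z.2)‖ₑ ^ 2 := by
      intro j
      rw [eLpNorm_congr_ae ((hv2 (σ j)).coeFn_toLp.sub EventuallyEq.rfl),
        MollifiedLimits.eLpNorm_two_pow_two]
      rfl
    have h3 := ENNReal.Tendsto.pow (n := 2) h1
    simp only [h2, ne_eq, OfNat.ofNat_ne_zero, not_false_eq_true, zero_pow] at h3
    exact h3

end Main

end Literature.Analysis.FluidPDE

end
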